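import Mathlib
import HarnessLib
import Literature.AlgebraicGeometry.HodgeTheory.WeilClassesBFSheafSeedAt
import Literature.AlgebraicGeometry.HodgeTheory.ISemiregularOfSchemeIso

/-!
# Pure-Weil Buchweitz–Flenner seeds: one model suffices, and they seed every class `h`

HONEST FRAMING: HELPER lemmas for the crux `TwistNormalisedKleimanSemiregularAnchor` (K2ᵀ,
stmt-HodgeConjecture-28148, route `KleimanBFSeeds`) and its registered first rung
`stub_rung_CMclass_d3 : KleimanAnchorRungCM 3` of the skeleton
`Cruxes/TwistNormalisedKleimanSemiregularAnchor/Lines/chosen_anchor.lean`, whose proved reduction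
`kleimanAnchorRungCM_of_pureWeilSeedOnTwistedSquare` asks for a PURE-WEIL semiregular seed
`HasPureWeilSeedAt C P w`: on EVERY model `X₀ ≅ P.X` an `I ∋ 3`-semiregular finite locally free `E₀` with
`chₙ(E₀) ↦ N·w` (`N ≠ 0`, no `hⁿ` term) and `ch_p(E₀) = 0` for `p ∈ I ∖ {n}`. NOTHING here constructs such a
sheaf; nothing proves the rung, K2ᵀ, `WeilSixfolds` (rung H2), HC_AV, HC_CM or HC. What is proved is
bookkeeping that shrinks what a prover of the rung has to write:

* §1 `forall_models_pureWeilSeed_iff_exists_on`: the every-model pure-Weil clause (stated UNFOLDED and for a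
  general degree `n`; for `n = 3` its left-hand side is literally the skeleton's `HasPureWeilSeedAt C P w`) is
  equivalent to its clause ON `P.X` ITSELF — push the one object forward along each model `e : P.X ≅ X₀`
  (`IsFiniteLocallyFree.pushforward_of_iso`, `IsISemiregular.of_schemeIso`,
  `ChernCharacterBetti.ch_pushforward_of_iso`), exactly as `hasBFSheafSeedAt_iff_exists_on`
  (`KleimanBFSeedsKleimanSemiregularAnchorReductions.lean`) does for `HasBFSheafSeedAt`.
* §2 `hasBFSheafSeedAt_of_pureWeilSeed_on`: ONE such object on `P.X` is a Buchweitz–Flenner sheaf seed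
  `HasBFSheafSeedAt C n P h w` at EVERY degree-2 class `h` (take `q = 0`, `c ≡ 0`): the one-model form of the
  skeleton's `hasBFSheafSeedAt_of_hasPureWeilSeedAt`.

So the rung's object is: ONE finite locally free `E₀` on `(T × T).X` (T the CM cube, `exists_twistedCMCube`),
`I ∋ 3`, `σ_{I-1}` injective, `C.ch₃ E₀ = N·w`, `C.ch_p E₀ = 0` (`p ∈ I ∖ 3`). By the seat's pen lemma
«THEOREM S» (crux workfile `SPLIT-SEEDS-DEAD-rung1-g0.md`) such an `E₀` is never a direct sum of line
bundles and has rank `≥ 3`; this file does not formalise that.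

References: [BuchweitzFlenner2003] §5 (I-semiregular), Thm. 5.1; [Fulton1998] §15.1 (ii).
-/

-- every declaration of this problem lives in `Summit.HodgeConjecture.HodgeConjecture.…` (summit = sub-problem)
set_option linter.dupNamespace false

noncomputable section

open CategoryTheory AlgebraicGeometry
open AlgebraicGeometry.Scheme.Modules

namespace Summit.HodgeConjecture.HodgeConjecture.Theorems

open Literature.AlgebraicGeometry Literature.AlgebraicGeometry.Motives Literature.AlgebraicGeometry.Modules
open Literature.AlgebraicGeometry.HodgeTheory
open Literature.AlgebraicTopology.SingularHomology

/-! ### §1 One model suffices for pure-Weil seeds -/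

section OneModel

variable {C : ChernCharacterBetti} {n : ℕ} {P : AbelianVariety ℂ} {w : complexBetti P.X (2 * n)}

/-- **One pure-Weil object on `P.X` gives the every-model pure-Weil seed**: an `I ∋ n`-semiregular finite locally
free `ℰ₀` on `P.X` with `chₙ(ℰ₀) = N·w` (`N ≠ 0`) and `ch_p(ℰ₀) = 0` (`p ∈ I ∖ n`) yields the clause on every model
`e : P.X ≅ X₀`: take `e_* ℰ₀` — finite locally free, `I`-semiregular there (`IsISemiregular.of_schemeIso`),
`e^* chₙ(e_*ℰ₀) = e^*(e⁻¹)^* chₙ(ℰ₀) = chₙ(ℰ₀)` and `ch_p(e_*ℰ₀) = (e⁻¹)^* 0 = 0`.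
[cite: BuchweitzFlenner2003, §5 (I-semiregular)] [cite: Fulton1998, §15.1 (ii)] -/
theorem forall_models_pureWeilSeed_of_exists_on
    (hS : ∃ (I : Finset ℕ) (E₀ : P.X.left.Modules) (hE₀ : IsFiniteLocallyFree E₀) (N : ℚ),
      n ∈ I ∧ N ≠ 0 ∧ IsISemiregular hE₀ {q' | q' + 1 ∈ I} ∧
      C.ch P.X E₀ n = ((N : ℚ) : ℂ) • w ∧ ∀ p' ∈ I, p' ≠ n → C.ch P.X E₀ p' = 0) :
    ∀ (X₀ : SchemeOver ℂ) (eX : P.X ≅ X₀), ∃ (I : Finset ℕ) (E₀ : X₀.left.Modules)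
      (hE₀ : IsFiniteLocallyFree E₀) (N : ℚ), n ∈ I ∧ N ≠ 0 ∧ IsISemiregular hE₀ {q' | q' + 1 ∈ I} ∧
      complexBetti.map eX.hom (2 * n) (C.ch X₀ E₀ n) = ((N : ℚ) : ℂ) • w ∧
      ∀ p' ∈ I, p' ≠ n → C.ch X₀ E₀ p' = 0 := by
  obtain ⟨I, E₀, hE₀, N, hnI, hN, hsr, hchn, hchp⟩ := hS
  intro X₀ e
  refine ⟨I, (pushforward e.hom.left).obj E₀, hE₀.pushforward_of_iso (leftIso' e), N, hnI, hN,
    IsISemiregular.of_schemeIso e hE₀ hsr, ?_, fun p' hp' hpn => ?_⟩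
  · rw [ChernCharacterBetti.ch_pushforward_of_iso C e hE₀,
      BuchweitzFlenner2003_variationalHodge_ISemiregular_model.map_hom_map_inv, hchn]
  · rw [ChernCharacterBetti.ch_pushforward_of_iso C e hE₀, hchp p' hp' hpn, map_zero]

/-- The every-model pure-Weil clause gives the one-model clause on `P.X` (model `Iso.refl`).
[cite: BuchweitzFlenner2003, §5 (I-semiregular)] -/
theorem exists_on_of_forall_models_pureWeilSeed
    (hS : ∀ (X₀ : SchemeOver ℂ) (eX : P.X ≅ X₀), ∃ (I : Finset ℕ) (E₀ : X₀.left.Modules)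
      (hE₀ : IsFiniteLocallyFree E₀) (N : ℚ), n ∈ I ∧ N ≠ 0 ∧ IsISemiregular hE₀ {q' | q' + 1 ∈ I} ∧
      complexBetti.map eX.hom (2 * n) (C.ch X₀ E₀ n) = ((N : ℚ) : ℂ) • w ∧
      ∀ p' ∈ I, p' ≠ n → C.ch X₀ E₀ p' = 0) :
    ∃ (I : Finset ℕ) (E₀ : P.X.left.Modules) (hE₀ : IsFiniteLocallyFree E₀) (N : ℚ),
      n ∈ I ∧ N ≠ 0 ∧ IsISemiregular hE₀ {q' | q' + 1 ∈ I} ∧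
      C.ch P.X E₀ n = ((N : ℚ) : ℂ) • w ∧ ∀ p' ∈ I, p' ≠ n → C.ch P.X E₀ p' = 0 := by
  obtain ⟨I, E₀, hE₀, N, hnI, hN, hsr, hchn, hchp⟩ := hS P.X (Iso.refl _)
  refine ⟨I, E₀, hE₀, N, hnI, hN, hsr, ?_, hchp⟩
  have h' := hchn
  simp only [Iso.refl_hom, complexBetti.map_id] at h'
  exact h'

/-- **The pure-Weil seed clause is its one-model clause** (the `∀ X₀ ≅ P.X` quantifier is free). For `n = 3`
the left-hand side is, verbatim, `HasPureWeilSeedAt C P w` of the K2ᵀ skeleton `Lines/chosen_anchor`.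
[cite: BuchweitzFlenner2003, §5 (I-semiregular)] [cite: Fulton1998, §15.1 (ii)] -/
theorem forall_models_pureWeilSeed_iff_exists_on :
    (∀ (X₀ : SchemeOver ℂ) (eX : P.X ≅ X₀), ∃ (I : Finset ℕ) (E₀ : X₀.left.Modules)
      (hE₀ : IsFiniteLocallyFree E₀) (N : ℚ), n ∈ I ∧ N ≠ 0 ∧ IsISemiregular hE₀ {q' | q' + 1 ∈ I} ∧
      complexBetti.map eX.hom (2 * n) (C.ch X₀ E₀ n) = ((N : ℚ) : ℂ) • w ∧
      ∀ p' ∈ I, p' ≠ n → C.ch X₀ E₀ p' = 0) ↔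
    ∃ (I : Finset ℕ) (E₀ : P.X.left.Modules) (hE₀ : IsFiniteLocallyFree E₀) (N : ℚ),
      n ∈ I ∧ N ≠ 0 ∧ IsISemiregular hE₀ {q' | q' + 1 ∈ I} ∧
      C.ch P.X E₀ n = ((N : ℚ) : ℂ) • w ∧ ∀ p' ∈ I, p' ≠ n → C.ch P.X E₀ p' = 0 :=
  ⟨exists_on_of_forall_models_pureWeilSeed, forall_models_pureWeilSeed_of_exists_on⟩

end OneModel

/-! ### §2 One pure-Weil object on `P.X` is a Buchweitz–Flenner sheaf seed at every class `h` -/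

/-- **One pure-Weil object seeds every `h`**: an `I ∋ n`-semiregular finite locally free `ℰ₀` on `P.X` with
`chₙ(ℰ₀) = N·w` (`N ≠ 0`) and `ch_p(ℰ₀) = 0` (`p ∈ I ∖ n`) gives `HasBFSheafSeedAt C n P h w` for EVERY
`h ∈ H²(P(ℂ); ℂ)` (`q = 0`, `c ≡ 0`; then one model suffices). No polarisation enters the object.
[cite: BuchweitzFlenner2003, §5 Thm. 5.1 and §5 (I-semiregular)] -/
theorem hasBFSheafSeedAt_of_pureWeilSeed_on {C : ChernCharacterBetti} {n : ℕ} {P : AbelianVariety ℂ}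
    {w : complexBetti P.X (2 * n)}
    (hS : ∃ (I : Finset ℕ) (E₀ : P.X.left.Modules) (hE₀ : IsFiniteLocallyFree E₀) (N : ℚ),
      n ∈ I ∧ N ≠ 0 ∧ IsISemiregular hE₀ {q' | q' + 1 ∈ I} ∧
      C.ch P.X E₀ n = ((N : ℚ) : ℂ) • w ∧ ∀ p' ∈ I, p' ≠ n → C.ch P.X E₀ p' = 0)
    (h : complexBetti P.X 2) : HasBFSheafSeedAt C n P h w := by
  intro X₀ eX
  obtain ⟨I, E₀, hE₀, N, hnI, hN, hsr, hchn, hchp⟩ :=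
    forall_models_pureWeilSeed_of_exists_on hS X₀ eX
  refine ⟨I, E₀, hE₀, 0, N, fun _ => 0, hnI, hN, hsr, ?_, fun p' hp' hpn => ?_⟩
  · simp only [hchn, Rat.cast_zero, zero_smul, zero_add]
  · simp only [hchp p' hp' hpn, map_zero, Rat.cast_zero, zero_smul]

end Summit.HodgeConjecture.HodgeConjecture.Theorems

end
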